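import Summits.QuantumFields.YangMills.Theorems.FluctuationComparisonRegPrIntLOrganTangentTwoConstantsMixed
import Summits.QuantumFields.YangMills.Theorems.FluctuationComparisonRegPrIntLOrganTangentTopConversionFiniteDifference
import HarnessLib

/-!
# «TOP CONVERSION» END-TO-END, BY KERNEL: real four-point smallness `σ` at every base point of a real square + holomorphy with ONE bound `B` on
# the bidisc ⟹ FINITE-DIFFERENCE Hessian-currency letters `k ≲ σ^{(1−r)(1−r′)}·θ²` — one theorem for the v18 typist

Cell `ym3-torus` (YM ladder rung R3 = continuum `SU(2)` Yang–Mills on the three-torus — a RUNG, NOT d = 4, NOT infinite volume, NOT a mass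
gap, NOT Clay).  LEAD-20520 width seat `ym-ust-20520-w3` (gen 24); `--supports stmt-QuantumFields-20520 --as helper`, count-neutral,
definition-free, default heartbeats; no registry, binder or `Lines/` edit (registered skeleton `Lines/semiclassical_s2beta.lean` v11.4, 0∕5,
★★OWNER RULING №36, untouched).

WHAT THIS IS.  The composition of ✓p795138 `…OrganTangentTwoConstantsMixed` (mixed derivative AT A BASE POINT `≲ σ^{(1−r)(1−r′)}` from real
four-point smallness on the square based there + a bidisc bound — two constants at the tip of a slit, twice, over the tree's GAN24 engine) and
✓p795215 `…OrganTangentTopConversionFiniteDifference` (finite mixed difference ≤ sup of the mixed derivative on the real rectangle × area;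
translates are holomorphic on the shrunk bidisc).  LEAD-20520 №15 priced the v18 design (β) at «1 M = `TopConversion` by Cauchy estimates on the
polydisc»; this file is that M as ONE kernel theorem in `g`-currency:

★★`norm_mixedDiff_le_of_realFourPoint_allBase` — `g : ℂ × ℂ → ℂ` holomorphic on `ball 0 ρ ×ˢ ball 0 ρ` with `‖g‖ ≤ B` (`0 < B`);
`0 < s₁`, `a + s₁·cosh 1 < ρ`; REAL four-point smallness `σ > 0` on every square `[σ₀, σ₀+s₁] × [τ₀, τ₀+s₁]` with base `(σ₀, τ₀) ∈ [0,a]²`;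
then for all `r, r′ ∈ ]0,1]` and all real `0 ≤ s, t ≤ a` with `s + t < ρ`:
`‖g(s,t) − g(s,0) − g(0,t) + g(0,0)‖ ≤ K·s·t`, `K := 25·(2·(4·(3B)∕(ρ−a)))^{r′}∕(s₁r′²) · (25·(2·(3B))^{r}∕(s₁r²)·σ^{1−r})^{1−r′}`;
★`abs_mixedDiff_le_scaled_of_realFourPoint_allBase` — the H-clause's SCALED, real-valued reading `|fZ − fV − fW + fU| ≤ (K·θ²)·(s∕θ)·(t∕θ)`.

HOW IT DOCKS (for the ideator successor ∕ v18 typist).  With (β) = `AnalyticPairWindowAt θ r_β B f` as drafted (`g` holomorphic on the bidisc of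
radius `r_β·θ` with ONE bound, real traces `g(↑s,↑t) = ↑(f (U·e^{sv}@b·e^{tv′}@b′))`) and the frozen seed's SIZE-BLIND letter `σ_K` — which holds
at EVERY window base point, and the four corners based at `U·e^{σ₀v}@b·e^{τ₀v′}@b′` are values of the SAME `g` (one-parameter subgroups) — take
`ρ := r_β·θ`, `a := ρ∕4`, `s₁ := ρ∕8` (so `a + s₁·cosh 1 < ρ` by `cosh 1 < 3`): the discrepancy's H-letters are `k_{bb′} := K·θ²` for real moves
`≤ r_β·θ∕8` (note `K·θ² = K′∕r_β²`-type constants: `K` scales like `θ^{−2}` through `ρ − a` and `s₁`, so `k` is θ-UNIFORM), size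
`∝ σ_K^{(1−r)(1−r′)}`.  Per-pair DECAY of `k` follows the decay of `σ_K·e^{−κ·tdist}` through the same power.
WHAT THIS IS NOT: nothing of Bałaban's ((β) inhabitation by the runs = [Balaban1985UV3] p.263's claim; `σ_K` = the frozen `RunPairSeed` letter,
a HYPOTHESIS); O1∕O1ᵘ-H∕S2ᴴ∕S3ᴴ, the five registered ∘-stubs, crux 20520 `FluctuationComparisonRegPrIntL`, `YM3TorusSU2` NOT proved; no summit
is proved by a helper.  R3 = SU(2) YM₃ on T³ — NOT d = 4, NOT infinite volume, NOT a mass gap, NOT Clay; the Yang–Mills mass gap is NOT proved.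
-/

noncomputable section

open Metric Set Complex
open Summit.QuantumFields.YangMills.Theorems.OrganTangentTwoConstantsMixed (norm_derivMixed_le_of_realFourPoint)
open Summit.QuantumFields.YangMills.Theorems.OrganTangentTopConversionFiniteDifference
  (differentiableOn_translate norm_translate_le deriv_translate_fst norm_mixedDiff_le_of_derivMixed_le)

namespace Summit.QuantumFields.YangMills.Theorems.OrganTangentTopConversion

variable {g : ℂ × ℂ → ℂ} {ρ B : ℝ}

/-- The mixed derivative of the translate at the origin is the mixed derivative of `g` at the base point. [folklore] -/
theorem derivMixed_translate (a b : ℂ) :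
    deriv (fun t : ℂ => deriv (fun s : ℂ => g (a + s, b + t)) 0) 0 =
      deriv (fun t : ℂ => deriv (fun s : ℂ => g (s, t)) a) b := by
  have h1 : (fun t : ℂ => deriv (fun s : ℂ => g (a + s, b + t)) 0) =
      fun t : ℂ => (fun τ : ℂ => deriv (fun s : ℂ => g (s, τ)) a) (b + t) := by
    funext t
    exact deriv_translate_fst a b t
  rw [h1]
  have h2 := deriv_comp_const_add (f := fun τ : ℂ => deriv (fun s : ℂ => g (s, τ)) a) b 0
  simpa using h2

/-- ★★ **TOP CONVERSION, END-TO-END.**  Real four-point smallness `σ` on every square of side `s₁` based in `[0,a]²` + holomorphy with bound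
`B` on the bidisc of radius `ρ` (`a + s₁·cosh 1 < ρ`) ⟹ for real `0 ≤ s, t ≤ a` with `s + t < ρ`, the finite mixed difference is
`≤ K·s·t` with `K = 25·(2·(4·(3B)∕(ρ−a)))^{r′}∕(s₁r′²) · (25·(2·(3B))^{r}∕(s₁r²)·σ^{1−r})^{1−r′}` — ✓`norm_derivMixed_le_of_realFourPoint` on
every translate with base in `[0,s] × [0,t]`, then ✓`norm_mixedDiff_le_of_derivMixed_le`. [folklore] -/
theorem norm_mixedDiff_le_of_realFourPoint_allBase {a s₁ σ : ℝ}
    (hg : DifferentiableOn ℂ g (ball (0 : ℂ) ρ ×ˢ ball (0 : ℂ) ρ))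
    (hB : ∀ p ∈ ball (0 : ℂ) ρ ×ˢ ball (0 : ℂ) ρ, ‖g p‖ ≤ B) (hB0 : 0 < B)
    (hs₁ : 0 < s₁) (haρ : a + s₁ * Real.cosh 1 < ρ)
    (hσ : ∀ σ₀ τ₀ : ℝ, 0 ≤ σ₀ → σ₀ ≤ a → 0 ≤ τ₀ → τ₀ ≤ a → ∀ s t : ℝ, 0 ≤ s → s ≤ s₁ → 0 ≤ t → t ≤ s₁ →
      ‖g ((σ₀ : ℂ) + (s : ℂ), (τ₀ : ℂ) + (t : ℂ)) - g ((σ₀ : ℂ) + (s : ℂ), (τ₀ : ℂ)) - g ((σ₀ : ℂ), (τ₀ : ℂ) + (t : ℂ))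
        + g ((σ₀ : ℂ), (τ₀ : ℂ))‖ ≤ σ) (hσ0 : 0 < σ)
    {r r' : ℝ} (hr : 0 < r) (hr1 : r ≤ 1) (hr' : 0 < r') (hr'1 : r' ≤ 1)
    {s t : ℝ} (hs : 0 ≤ s) (hsa : s ≤ a) (ht : 0 ≤ t) (hta : t ≤ a) (hst : s + t < ρ) :
    ‖g ((s : ℂ), (t : ℂ)) - g ((s : ℂ), 0) - g (0, (t : ℂ)) + g (0, 0)‖ ≤
      (25 * (2 * (4 * (3 * B) / (ρ - a))) ^ r' / (s₁ * r' ^ 2) *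
        (25 * (2 * (3 * B)) ^ r / (s₁ * r ^ 2) * σ ^ (1 - r)) ^ (1 - r')) * s * t := by
  refine norm_mixedDiff_le_of_derivMixed_le hg hs ht hst ?_
  intro σ₀ τ₀ hσ₀ hσ₀s hτ₀ hτ₀t
  have hσ₀a : σ₀ ≤ a := hσ₀s.trans hsa
  have hτ₀a : τ₀ ≤ a := hτ₀t.trans hta
  have hna : ‖(σ₀ : ℂ)‖ ≤ a := by rw [Complex.norm_real, Real.norm_eq_abs, abs_of_nonneg hσ₀]; exact hσ₀a
  have hnb : ‖(τ₀ : ℂ)‖ ≤ a := by rw [Complex.norm_real, Real.norm_eq_abs, abs_of_nonneg hτ₀]; exact hτ₀a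
  -- the translate with base (σ₀, τ₀)
  have hgT := differentiableOn_translate hg hna hnb
  have hBT : ∀ p ∈ ball (0 : ℂ) (ρ - a) ×ˢ ball (0 : ℂ) (ρ - a), ‖g ((σ₀ : ℂ) + p.1, (τ₀ : ℂ) + p.2)‖ ≤ B :=
    fun p hp => norm_translate_le hB hna hnb hp
  have hs₁ρ : s₁ * Real.cosh 1 < ρ - a := by linarith
  have hσT : ∀ s' t' : ℝ, 0 ≤ s' → s' ≤ s₁ → 0 ≤ t' → t' ≤ s₁ →
      ‖g ((σ₀ : ℂ) + ((s' : ℂ), (t' : ℂ)).1, (τ₀ : ℂ) + ((s' : ℂ), (t' : ℂ)).2) -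
        g ((σ₀ : ℂ) + ((s' : ℂ), (0 : ℂ)).1, (τ₀ : ℂ) + ((s' : ℂ), (0 : ℂ)).2) -
        g ((σ₀ : ℂ) + ((0 : ℂ), (t' : ℂ)).1, (τ₀ : ℂ) + ((0 : ℂ), (t' : ℂ)).2) +
        g ((σ₀ : ℂ) + ((0 : ℂ), (0 : ℂ)).1, (τ₀ : ℂ) + ((0 : ℂ), (0 : ℂ)).2)‖ ≤ σ := by
    intro s' t' hs'0 hs'1 ht'0 ht'1
    have key := hσ σ₀ τ₀ hσ₀ hσ₀a hτ₀ hτ₀a s' t' hs'0 hs'1 ht'0 ht'1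
    simpa only [add_zero] using key
  have key := norm_derivMixed_le_of_realFourPoint (g := fun p : ℂ × ℂ => g ((σ₀ : ℂ) + p.1, (τ₀ : ℂ) + p.2))
    hs₁ hs₁ρ hgT hBT hB0 hσT hσ0 hr hr1 hr' hr'1
  have hid := derivMixed_translate (g := g) (σ₀ : ℂ) (τ₀ : ℂ)
  simp only at key
  rw [hid] at key
  exact key

/-- ★ **THE H-CLAUSE'S SCALED, REAL-VALUED READING** (window scale `θ > 0`; the predicate (β)'s `g (↑s, ↑t) = ↑(f Z)` at the four corners):
under the hypotheses of `norm_mixedDiff_le_of_realFourPoint_allBase`, `|fZ − fV − fW + fU| ≤ (K·θ²)·(s∕θ)·(t∕θ)`. [folklore] -/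
theorem abs_mixedDiff_le_scaled_of_realFourPoint_allBase {a s₁ σ : ℝ}
    (hg : DifferentiableOn ℂ g (ball (0 : ℂ) ρ ×ˢ ball (0 : ℂ) ρ))
    (hB : ∀ p ∈ ball (0 : ℂ) ρ ×ˢ ball (0 : ℂ) ρ, ‖g p‖ ≤ B) (hB0 : 0 < B)
    (hs₁ : 0 < s₁) (haρ : a + s₁ * Real.cosh 1 < ρ)
    (hσ : ∀ σ₀ τ₀ : ℝ, 0 ≤ σ₀ → σ₀ ≤ a → 0 ≤ τ₀ → τ₀ ≤ a → ∀ s t : ℝ, 0 ≤ s → s ≤ s₁ → 0 ≤ t → t ≤ s₁ →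
      ‖g ((σ₀ : ℂ) + (s : ℂ), (τ₀ : ℂ) + (t : ℂ)) - g ((σ₀ : ℂ) + (s : ℂ), (τ₀ : ℂ)) - g ((σ₀ : ℂ), (τ₀ : ℂ) + (t : ℂ))
        + g ((σ₀ : ℂ), (τ₀ : ℂ))‖ ≤ σ) (hσ0 : 0 < σ)
    {r r' : ℝ} (hr : 0 < r) (hr1 : r ≤ 1) (hr' : 0 < r') (hr'1 : r' ≤ 1)
    {θ s t : ℝ} (hθ : 0 < θ) (hs : 0 ≤ s) (hsa : s ≤ a) (ht : 0 ≤ t) (hta : t ≤ a) (hst : s + t < ρ)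
    {fZ fV fW fU : ℝ} (hZ : g ((s : ℂ), (t : ℂ)) = fZ) (hV : g ((s : ℂ), 0) = fV) (hW : g (0, (t : ℂ)) = fW) (hU : g (0, 0) = fU) :
    |fZ - fV - fW + fU| ≤
      (25 * (2 * (4 * (3 * B) / (ρ - a))) ^ r' / (s₁ * r' ^ 2) *
        (25 * (2 * (3 * B)) ^ r / (s₁ * r ^ 2) * σ ^ (1 - r)) ^ (1 - r')) * θ ^ 2 * (s / θ) * (t / θ) := by
  have key := norm_mixedDiff_le_of_realFourPoint_allBase hg hB hB0 hs₁ haρ hσ hσ0 hr hr1 hr' hr'1 hs hsa ht hta hst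
  rw [hZ, hV, hW, hU] at key
  have hcast : ((fZ : ℂ) - fV - fW + fU) = ((fZ - fV - fW + fU : ℝ) : ℂ) := by push_cast; ring
  rw [hcast, Complex.norm_real, Real.norm_eq_abs] at key
  calc |fZ - fV - fW + fU| ≤ (25 * (2 * (4 * (3 * B) / (ρ - a))) ^ r' / (s₁ * r' ^ 2) *
        (25 * (2 * (3 * B)) ^ r / (s₁ * r ^ 2) * σ ^ (1 - r)) ^ (1 - r')) * s * t := key
    _ = (25 * (2 * (4 * (3 * B) / (ρ - a))) ^ r' / (s₁ * r' ^ 2) *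
        (25 * (2 * (3 * B)) ^ r / (s₁ * r ^ 2) * σ ^ (1 - r)) ^ (1 - r')) * θ ^ 2 * (s / θ) * (t / θ) := by
      field_simp

end Summit.QuantumFields.YangMills.Theorems.OrganTangentTopConversion

end
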